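import Summits.Ventures.DiscreteObjects.UnitDistance.KernelRupCheck
import HarnessLib

/-!
# The 3-colouring CNF of a graph for the kernel RUP checker — clause generator and its soundness

Framing (verbatim for the cell): lottery ticket; floor = certified bounds/negative ranges.

Cell `pub-namedobj`, target (U), seat udg g12.  For a graph on the vertices `0 … n−1` given by neighbourhood bit-sets
`nb v` (as in `KernelColouringSearch.lean`), the CNF `cnfOf nb n v₀ v₁` has the variables `x_(v,c) = 3v + c` ('vertex `v`
has colour `c`', `c < 3`) and the clauses, in this order (ids `1, 2, …` for the RUP checker of `KernelRupCheck.lean`):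
`x_(v,0) ∨ x_(v,1) ∨ x_(v,2)` for every `v`; `¬x_(v,c) ∨ ¬x_(w,c)` for every edge `v < w` (bit `w` of `nb v`) and colour `c`;
the symmetry-breaking units `x_(v₀,0)` and `x_(v₁,1)`.  SOUNDNESS (`cnfOf_true`): a proper 3-colouring `col` with
`col v₀ = 0`, `col v₁ = 1` makes every clause true under the assignment `σ x = (col (x/3) = x % 3)`; the proof goes through
the syntactic recogniser `validClause` (checked clause by clause), so it does not depend on how the list was generated.
Consequence (`not_proper_of_rup`): a kernel-checked RUP refutation of `cnfOf nb n v₀ v₁` plus derived clauses excludes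
every such colouring.
-/

namespace Summit.Ventures.DiscreteObjects.UnitDistance.KRup

/-! ## The CNF -/

/-- Positive literal 'vertex `v` has colour `c`'. -/
def pos (v c : ℕ) : ℕ := 2 * (3 * v + c)
/-- Negative literal 'vertex `v` does not have colour `c`'. -/
def negl (v c : ℕ) : ℕ := 2 * (3 * v + c) + 1

/-- Edge clauses of vertex `v` against the neighbours `w > v` among `w < n` (three colours each). -/
def edgeClauses (nb : ℕ → ℕ) (n v : ℕ) : List (List ℕ) :=
  ((List.range n).filter fun w => v < w && Nat.testBit (nb v) w).flatMap fun w =>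
    [[negl v 0, negl w 0], [negl v 1, negl w 1], [negl v 2, negl w 2]]

/-- THE CNF of 'the graph `nb` on `n` vertices has a proper 3-colouring with `v₀ ↦ 0`, `v₁ ↦ 1`'. -/
def cnfOf (nb : ℕ → ℕ) (n v₀ v₁ : ℕ) : List (List ℕ) :=
  ((List.range n).map fun v => [pos v 0, pos v 1, pos v 2]) ++
    ((List.range n).flatMap fun v => edgeClauses nb n v) ++ [[pos v₀ 0], [pos v₁ 1]]

/-! ## Semantics -/

/-- A proper 3-colouring of the graph `nb` on the vertices `< n` (colours `0, 1, 2`). -/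
def Proper3 (nb : ℕ → ℕ) (n : ℕ) (col : ℕ → ℕ) : Prop :=
  ∀ v, v < n → col v < 3 ∧ ∀ w, w < n → Nat.testBit (nb v) w = true → col w ≠ col v

/-- The assignment of a colouring: `x_(v,c)` is true iff `col v = c`. -/
def assignOf (col : ℕ → ℕ) : ℕ → Bool := fun x => decide (col (x / 3) = x % 3)

/-- Syntactic recogniser of the admissible clause shapes (vertex clause, edge clause of an actual edge, the two units). -/
def validClause (nb : ℕ → ℕ) (n v₀ v₁ : ℕ) : List ℕ → Bool
  | [a] => a == pos v₀ 0 || a == pos v₁ 1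
  | [a, b] => a % 2 == 1 && b % 2 == 1 && (a / 2) % 3 == (b / 2) % 3 && decide ((a / 2) / 3 < n) &&
      decide ((b / 2) / 3 < n) && Nat.testBit (nb ((a / 2) / 3)) ((b / 2) / 3)
  | [a, b, c] => a == pos (a / 6) 0 && b == pos (a / 6) 1 && c == pos (a / 6) 2 && decide (a / 6 < n)
  | _ => false

/-- Truth value of a positive literal under the assignment of a colouring. -/
theorem litTrue_pos (col : ℕ → ℕ) (v c : ℕ) (hc : c < 3) :
    litTrue (assignOf col) (pos v c) = decide (col v = c) := by
  unfold litTrue assignOf pos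
  have h1 : 2 * (3 * v + c) / 2 = 3 * v + c := by omega
  have h2 : (3 * v + c) / 3 = v := by omega
  have h3 : (3 * v + c) % 3 = c := by omega
  have h4 : 2 * (3 * v + c) % 2 = 0 := by omega
  rw [h1, h2, h3, h4]
  simp

/-- Truth value of a negative literal under the assignment of a colouring. -/
theorem litTrue_odd (col : ℕ → ℕ) (a : ℕ) (ha : a % 2 = 1) :
    litTrue (assignOf col) a = !decide (col ((a / 2) / 3) = (a / 2) % 3) := by
  unfold litTrue assignOf
  have : (a % 2 == 0) = false := by simp [ha]
  rw [this]
  cases decide (col (a / 2 / 3) = a / 2 % 3) <;> rfl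

/-- SOUNDNESS OF THE RECOGNISER: every admissible clause is true under the assignment of a normalised proper colouring. -/
theorem validClause_true {nb : ℕ → ℕ} {n v₀ v₁ : ℕ} {col : ℕ → ℕ} (hP : Proper3 nb n col) (h0 : col v₀ = 0)
    (h1 : col v₁ = 1) (C : List ℕ) (hC : validClause nb n v₀ v₁ C = true) : clauseTrue (assignOf col) C = true := by
  rcases C with _ | ⟨a, _ | ⟨b, _ | ⟨c, _ | ⟨e, t⟩⟩⟩⟩
  · simp [validClause] at hC
  · -- unit clause
    simp only [validClause, Bool.or_eq_true, beq_iff_eq] at hC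
    simp only [clauseTrue, List.any_cons, List.any_nil, Bool.or_false]
    rcases hC with rfl | rfl
    · rw [litTrue_pos col v₀ 0 (by omega), h0]; rfl
    · rw [litTrue_pos col v₁ 1 (by omega), h1]; rfl
  · -- edge clause
    simp only [validClause, Bool.and_eq_true, beq_iff_eq, decide_eq_true_eq] at hC
    obtain ⟨⟨⟨⟨⟨ha, hb⟩, hab⟩, hva⟩, hwb⟩, hbit⟩ := hC
    simp only [clauseTrue, List.any_cons, List.any_nil, Bool.or_false]
    rw [litTrue_odd col a ha, litTrue_odd col b hb]
    have hne := (hP _ hva).2 _ hwb hbit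
    cases hda : decide (col (a / 2 / 3) = a / 2 % 3) <;> cases hdb : decide (col (b / 2 / 3) = b / 2 % 3) <;> simp
    rw [decide_eq_true_eq] at hda hdb
    exact hne (by rw [hdb, hda, hab])
  · -- vertex clause
    simp only [validClause, Bool.and_eq_true, beq_iff_eq, decide_eq_true_eq] at hC
    obtain ⟨⟨⟨ha, hb⟩, hc⟩, hv⟩ := hC
    simp only [clauseTrue, List.any_cons, List.any_nil, Bool.or_false]
    rw [ha, hb, hc, litTrue_pos col _ 0 (by omega), litTrue_pos col _ 1 (by omega), litTrue_pos col _ 2 (by omega)]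
    have hlt := (hP _ hv).1
    have h3 : col (a / 6) = 0 ∨ col (a / 6) = 1 ∨ col (a / 6) = 2 := by omega
    rcases h3 with h | h | h <;> simp [h]
  · simp [validClause] at hC

/-- If every clause of a list passes the recogniser, all of them are true under a normalised proper colouring. -/
theorem all_true_of_valid {nb : ℕ → ℕ} {n v₀ v₁ : ℕ} {col : ℕ → ℕ} (hP : Proper3 nb n col) (h0 : col v₀ = 0)
    (h1 : col v₁ = 1) {F : List (List ℕ)} (hF : F.all (validClause nb n v₀ v₁) = true) :
    ∀ C ∈ F, clauseTrue (assignOf col) C = true := by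
  rw [List.all_eq_true] at hF
  exact fun C hC => validClause_true hP h0 h1 C (hF C hC)

/-- MAIN CONSEQUENCE: if the clause list `F` passes the recogniser and a RUP proof (possibly in several pieces, the derived
clauses of earlier pieces appended to the store of later ones) derives the empty clause, then the graph has no proper
3-colouring with `v₀ ↦ 0`, `v₁ ↦ 1`.  One-piece form: -/
theorem not_proper_of_rup {nb : ℕ → ℕ} {n v₀ v₁ : ℕ} {F : List (List ℕ)} (hF : F.all (validClause nb n v₀ v₁) = true)
    {f d : ℕ} {steps : List (List ℕ × List ℕ)} (hrun : checkAll f d (Store.ofList d F) (F.length + 1) steps = true)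
    (hnil : [] ∈ steps.map Prod.fst) {col : ℕ → ℕ} (hP : Proper3 nb n col) (h0 : col v₀ = 0) (h1 : col v₁ = 1) :
    False :=
  checkAll_refutes (Store.All.ofList d (all_true_of_valid hP h0 h1 hF)) hrun hnil

end Summit.Ventures.DiscreteObjects.UnitDistance.KRup
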